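import Summits.AnomalousDissipation.AnomalousDissipation.Theses.TwoAndHalfD
import Summits.AnomalousDissipation.AnomalousDissipation.Theorems.TwoAndHalfDScalarAnomalySteadySourceFormalColdStartVariance
import Summits.AnomalousDissipation.AnomalousDissipation.Theorems.TwoAndHalfDScalarAnomalySteadySourceFormalColdStartVarianceToolkit
import Literature.Analysis.FluidPDE.PassiveScalarWellPosednessProofs
import Literature.Analysis.FluidPDE.PassiveScalarClassicalEnergy
import Literature.Analysis.FluidPDE.PassiveScalarForced

/-!
# J1a `stub_globalRelease`: global classical releases of a smooth pattern

Stub J1a of the line `Sketch` (duhamel-release) for the crux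
`Summit.AnomalousDissipation.AnomalousDissipation.Theses.TwoAndHalfD.TwohalfdThesis`
(stmt-AnomalousDissipation-0206); the statement is registered verbatim in the line's checked
skeleton and is consumed by the kernel-checked composition there.

CONTENT. For `κ > 0`, a release time `s ≥ 0`, a drift `u` jointly smooth and divergence free on
`[0, ∞) × T²` and a smooth pattern `h`, there is a GLOBAL classical solution `φ` of the unforced
passive-scalar equation `∂ₜφ + u·∇φ = κΔφ` on `[s, ∞) × T²` with `φ(s) = h`
(`Torus.IsClassicalScalarTransportOn (Ici s)`).

PROOF (continuation; general dimension `d`).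
* `exists_global_release_zero` — the case `s = 0`: the tree's classical solutions of the
  forced equation with the ZERO source on `[0, N + 1]`
  (`Torus.exists_isClassicalScalarTransportForcedOn`) are pairwise compatible by uniqueness
  (`IsClassicalScalarTransportForcedOn.eq_on_Icc`, restriction `ColdStartVariance.forced_restrict`),
  and the glued field `φ(t) = φ_{⌊t⌋}(t)` is a classical solution on `[0, ∞)` because joint
  smoothness is local (Mathlib `contDiffOn_of_locally_contDiffOn`) and the one-sided time
  derivative within `[0, ∞)` at `t < N + 1` only sees `[0, N + 1)` — verbatim the gluing of
  `ColdStartVariance.exists_global_coldStart` (Robinson–Rodrigo–Sadowski 2016, §8.1).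
* `exists_global_release` — the case `s ≥ 0`: apply the case `s = 0` to the shifted drift
  `u(· + s)` (jointly smooth and divergence free on `[0, ∞)` as `s ≥ 0`) and shift the solution
  back (`Torus.IsSmoothSpaceTimeOn.comp_add_const`, `Torus.timeDerivWithin_comp_add_const`), as
  `ColdStartVariance.exists_release` does on windows.
* `stub_globalRelease` — the registered `Fin 2` statement, a one-line corollary.
Supports stmt-AnomalousDissipation-0206. [folklore: Krylov 1996, Thm. 9.2.3 (existence and
uniqueness on `[0, T]`); Robinson–Rodrigo–Sadowski 2016, §8.1 (continuation)]
-/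

noncomputable section

-- the summit path `AnomalousDissipation/AnomalousDissipation` duplicates a namespace component
set_option linter.dupNamespace false

namespace Summit.AnomalousDissipation.AnomalousDissipation.Theorems.TwohalfdThesis

open MeasureTheory Set Filter Topology
open scoped ENNReal NNReal InnerProductSpace
open Literature.Analysis.FunctionSpaces Literature.Analysis.FluidPDE
open Summit.AnomalousDissipation.AnomalousDissipation.Theorems.ScalarAnomalySteadySourceFormal.ColdStartVariance

variable {d : Type*} [Fintype d] [DecidableEq d]

/-! ## Global releases at time `0` (general dimension) -/

/-- **Global release at time `0`.** For `κ > 0`, a drift jointly smooth and divergence free on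
`[0, ∞) × T^d` and a smooth datum `ψ`, there is a classical solution `φ` of the unforced
equation `∂ₜφ + u·∇φ = κΔφ` on `[0, ∞) × T^d` with `φ(0) = ψ`: the tree's unique classical
solutions of the forced equation with zero source on `[0, N + 1]`
(`Torus.exists_isClassicalScalarTransportForcedOn`, uniqueness
`IsClassicalScalarTransportForcedOn.eq_on_Icc`) are pairwise compatible, and the glued field
`φ(t) = φ_{⌊t⌋}(t)` is a classical solution on `[0, ∞)` because joint smoothness is local
(Mathlib `contDiffOn_of_locally_contDiffOn`) and the one-sided time derivative within `[0, ∞)`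
at `t < N + 1` only sees `[0, N + 1)` (the gluing of `ColdStartVariance.exists_global_coldStart`;
Robinson–Rodrigo–Sadowski 2016, §8.1). [folklore] -/
theorem exists_global_release_zero {κ : ℝ} {u : ℝ → UnitAddTorus d → EuclideanSpace ℝ d}
    {ψ : UnitAddTorus d → ℝ} (hκ : 0 < κ)
    (hu : Torus.IsSmoothSpaceTimeOn (Ici 0) u) (hdiv : ∀ t ∈ Ici (0 : ℝ), Torus.IsDivFree (u t))
    (hψ : Torus.IsSmooth ψ) :
    ∃ φ : ℝ → UnitAddTorus d → ℝ,
      Torus.IsClassicalScalarTransportOn (Ici 0) κ u φ ∧ φ 0 = ψ := by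
  -- adapted from `ColdStartVariance.exists_global_coldStart` (zero source, datum `ψ`)
  -- the solutions on `[0, N + 1]`
  have hsol : ∀ N : ℕ, ∃ θN : ℝ → UnitAddTorus d → ℝ,
      Torus.IsClassicalScalarTransportForcedOn (Icc 0 ((N : ℝ) + 1)) κ u
        (fun (_ : ℝ) (_ : UnitAddTorus d) => (0 : ℝ)) θN ∧ θN 0 = ψ := by
    intro N
    have hN : (0 : ℝ) < N + 1 := by positivity
    exact Torus.exists_isClassicalScalarTransportForcedOn hκ hN (hu.mono Icc_subset_Ici_self)
      (fun t ht => hdiv t (Icc_subset_Ici_self ht))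
      (Torus.isSmoothSpaceTimeOn_const (Torus.isSmooth_const _) _) hψ
  choose Θ hΘ hΘ0 using hsol
  -- compatibility by uniqueness
  have hagree : ∀ N M : ℕ, N ≤ M → ∀ t ∈ Icc (0 : ℝ) (N + 1), Θ N t = Θ M t := by
    intro N M hNM t ht
    have hN : (0 : ℝ) < N + 1 := by positivity
    have hsub : Icc (0 : ℝ) (N + 1) ⊆ Icc 0 (M + 1) :=
      Icc_subset_Icc le_rfl (by exact_mod_cast Nat.succ_le_succ hNM)
    exact Torus.IsClassicalScalarTransportForcedOn.eq_on_Icc hκ hN (hΘ N)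
      (forced_restrict (hΘ M) hsub (uniqueDiffOn_Icc hN)) ((hΘ0 N).trans (hΘ0 M).symm) t ht
  -- the glued field
  set θ : ℝ → UnitAddTorus d → ℝ := fun t => Θ ⌊t⌋₊ t with hθ_def
  have hθeq : ∀ N : ℕ, ∀ t ∈ Icc (0 : ℝ) (N + 1), θ t = Θ N t := by
    intro N t ht
    rcases le_total ⌊t⌋₊ N with hle | hle
    · exact hagree _ _ hle t ⟨ht.1, (Nat.lt_floor_add_one t).le⟩
    · exact (hagree _ _ hle t ht).symm
  have hθ0 : θ 0 = ψ := by
    change Θ ⌊(0 : ℝ)⌋₊ 0 = ψ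
    rw [Nat.floor_zero]
    exact hΘ0 0
  refine ⟨θ, ⟨hu, ?_, fun t ht x => ?_, hdiv⟩, hθ0⟩
  · -- joint smoothness is local
    refine contDiffOn_of_locally_contDiffOn fun z hz => ?_
    obtain ⟨t, y⟩ := z
    set N : ℕ := ⌊t⌋₊ with hN_def
    refine ⟨Iio ((N : ℝ) + 1) ×ˢ univ, isOpen_Iio.prod isOpen_univ,
      ⟨Nat.lt_floor_add_one t, mem_univ _⟩, ?_⟩
    have hset : (Ici (0 : ℝ) ×ˢ (univ : Set (EuclideanSpace ℝ d))) ∩ Iio ((N : ℝ) + 1) ×ˢ univ ⊆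
        Icc 0 ((N : ℝ) + 1) ×ˢ univ := by
      rw [prod_inter_prod, inter_self]
      exact prod_mono (fun τ hτ => ⟨hτ.1, le_of_lt hτ.2⟩) subset_rfl
    refine (ContDiffOn.mono (hΘ N).smooth_scalar hset).congr fun z hz => ?_
    obtain ⟨τ, y'⟩ := z
    have hτ : τ ∈ Icc (0 : ℝ) (N + 1) := ⟨hz.1.1, le_of_lt hz.2.1⟩
    simp only [Torus.stLift_apply]
    rw [hθeq N τ hτ]
  · -- the equation at `t ≥ 0`: compare with `Θ N` on `[0, N + 1)`, `N = ⌊t⌋`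
    set N : ℕ := ⌊t⌋₊ with hN_def
    have htlt : t < (N : ℝ) + 1 := Nat.lt_floor_add_one t
    have htN : t ∈ Icc (0 : ℝ) (N + 1) := ⟨ht, htlt.le⟩
    have hD : Torus.timeDerivWithin (Ici 0) θ t x =
        Torus.timeDerivWithin (Icc 0 ((N : ℝ) + 1)) (Θ N) t x := by
      have h1 : HasDerivWithinAt (fun τ => Θ N τ x)
          (Torus.timeDerivWithin (Icc 0 ((N : ℝ) + 1)) (Θ N) t x) (Icc 0 ((N : ℝ) + 1)) t :=
        (hΘ N).smooth_scalar.hasDerivWithinAt_slice htN x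
      have h2 : HasDerivWithinAt (fun τ => θ τ x)
          (Torus.timeDerivWithin (Icc 0 ((N : ℝ) + 1)) (Θ N) t x) (Ico 0 ((N : ℝ) + 1)) t :=
        (h1.mono Ico_subset_Icc_self).congr
          (fun τ hτ => by rw [hθeq N τ (Ico_subset_Icc_self hτ)]) (by rw [hθeq N t htN])
      have hmem : Ico (0 : ℝ) ((N : ℝ) + 1) ∈ 𝓝[Ici 0] t := by
        rw [← Ici_inter_Iio]
        exact inter_mem_nhdsWithin _ (Iio_mem_nhds htlt)
      exact (h2.mono_of_mem_nhdsWithin hmem).derivWithin (uniqueDiffOn_Ici 0 t ht)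
    rw [hD, hθeq N t htN]
    have h := (hΘ N).transport t htN x
    rwa [add_zero] at h

/-! ## Global releases at time `s ≥ 0` (general dimension) -/

/-- **Global release at time `s ≥ 0`.** For `κ > 0`, a drift jointly smooth and divergence free
on `[0, ∞) × T^d`, a release time `s ≥ 0` and a smooth datum `ψ`, there is a classical solution
`φ` of the unforced equation `∂ₜφ + u·∇φ = κΔφ` on `[s, ∞) × T^d` with `φ(s) = ψ`: apply
`exists_global_release_zero` to the time-shifted drift `u(· + s)` (jointly smooth and
divergence free on `[0, ∞)` since `s ≥ 0`) and shift the solution back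
(`Torus.IsSmoothSpaceTimeOn.comp_add_const`, `Torus.timeDerivWithin_comp_add_const`; the
window version is `ColdStartVariance.exists_release`). [folklore] -/
theorem exists_global_release {κ s : ℝ} {u : ℝ → UnitAddTorus d → EuclideanSpace ℝ d}
    {ψ : UnitAddTorus d → ℝ} (hκ : 0 < κ)
    (hu : Torus.IsSmoothSpaceTimeOn (Ici 0) u) (hdiv : ∀ t ∈ Ici (0 : ℝ), Torus.IsDivFree (u t))
    (hs : 0 ≤ s) (hψ : Torus.IsSmooth ψ) :
    ∃ φ : ℝ → UnitAddTorus d → ℝ,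
      Torus.IsClassicalScalarTransportOn (Ici s) κ u φ ∧ φ s = ψ := by
  -- adapted from `ColdStartVariance.exists_release` (windows `[s, s + τ]`)
  -- the shifted drift on `[0, ∞)`
  have hu' : Torus.IsSmoothSpaceTimeOn (Ici 0) (fun t => u (t + s)) :=
    (hu.comp_add_const s).mono fun t ht => show 0 ≤ t + s from add_nonneg (mem_Ici.1 ht) hs
  have hdiv' : ∀ t ∈ Ici (0 : ℝ), Torus.IsDivFree ((fun t => u (t + s)) t) := fun t ht =>
    hdiv (t + s) (show 0 ≤ t + s from add_nonneg (mem_Ici.1 ht) hs)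
  obtain ⟨φ', hφ', hφ'0⟩ := exists_global_release_zero hκ hu' hdiv' hψ
  have hpre : (· + -s) ⁻¹' Ici (0 : ℝ) = Ici s := by
    ext t
    simp only [mem_preimage, mem_Ici]
    constructor <;> intro h <;> linarith
  refine ⟨fun t => φ' (t + -s),
    ⟨hu.mono fun t ht => show (0 : ℝ) ≤ t from hs.trans (mem_Ici.1 ht), ?_, fun t ht x => ?_,
      fun t ht => hdiv t (show (0 : ℝ) ≤ t from hs.trans (mem_Ici.1 ht))⟩, ?_⟩
  · have h := hφ'.smooth_scalar.comp_add_const (-s)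
    rwa [hpre] at h
  · have h1 := Torus.timeDerivWithin_comp_add_const (Ici 0) φ' (-s) t x
    rw [hpre] at h1
    rw [h1]
    have ht' : t + -s ∈ Ici (0 : ℝ) := by
      have hst : s ≤ t := mem_Ici.1 ht
      show (0 : ℝ) ≤ t + -s
      linarith
    have h2 := hφ'.transport (t + -s) ht' x
    rw [neg_add_cancel_right] at h2
    exact h2
  · funext x
    simp [hφ'0]

/-! ## The stub -/

/-- **J1a `stub_globalRelease` (line `Sketch`, crux `TwoAndHalfD.TwohalfdThesis`).** For every
viscosity `κ > 0`, every release time `s ≥ 0`, every drift `u` jointly smooth and divergence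
free on `[0, ∞) × T²` (e.g. a classical Navier–Stokes velocity) and every smooth pattern `h`,
there is a GLOBAL classical solution `φ` of the unforced passive-scalar equation
`∂ₜφ + u·∇φ = κΔφ` on `[s, ∞) × T²` with `φ(s) = h` — the `Fin 2` case of
`exists_global_release` (windowed existence `ColdStartVariance.exists_release` glued along
`[s, s + N + 1]` by uniqueness; continuation argument). [folklore] -/
theorem stub_globalRelease :
    ∀ (κ s : ℝ) (u : ℝ → (UnitAddTorus (Fin 2)) → (EuclideanSpace ℝ (Fin 2)))
      (h : (UnitAddTorus (Fin 2)) → ℝ), 0 < κ → 0 ≤ s → Torus.IsSmoothSpaceTimeOn (Ici 0) u →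
      (∀ t ∈ Ici (0 : ℝ), Torus.IsDivFree (u t)) → Torus.IsSmooth h →
      ∃ φ : ℝ → (UnitAddTorus (Fin 2)) → ℝ,
        Torus.IsClassicalScalarTransportOn (Ici s) κ u φ ∧ φ s = h :=
  fun _ _ _ _ hκ hs hu hdiv hh => exists_global_release hκ hu hdiv hs hh

end Summit.AnomalousDissipation.AnomalousDissipation.Theorems.TwohalfdThesis

end
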